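import Literature.MathematicalPhysics.QuantumFieldTheory.Balaban1983to89.B9Eq326G1kSupRowClosed
import Literature.MathematicalPhysics.QuantumFieldTheory.Balaban1983to89.B9Eq3126H1SupRowOfLetters
import Literature.MathematicalPhysics.QuantumFieldTheory.Balaban1983to89.B9Eq3126QG1QInvPointDecayTowerDiagonalClosed
import Literature.MathematicalPhysics.QuantumFieldTheory.Balaban1983to89.B9Eq3126H1BlockDecayOfLettersTower
import Literature.MathematicalPhysics.QuantumFieldTheory.Balaban1983to89.B9Eq315QkSingleBondLetter
import Literature.MathematicalPhysics.QuantumFieldTheory.Balaban1983to89.B9Eq349BlockDistanceWeight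

/-!
# `Balaban1983to89.B9Eq3126H1kSupRowClosed` — T. Bałaban, *Propagators for lattice gauge theories in a background field*, Commun. Math. Phys. **99** (1985)
# 389–434 [Balaban1985BackgroundPropagators] (3.126) p. 420 (*«HB = GQ*(QGQ*)⁻¹B»*), (3.132)–(3.133) p. 422, Thm 3.3 p. 399, Thm 3.11 p. 416, with
# [Balaban1985Variational] (45) p. 285: **THE SUP ROW OF THE TOWER MINIMIZER `H₁,k(U) = G₁,kQ_k†(Q_kG₁,kQ_k†)⁻¹` (coarse bonds → fine bonds) ON PRINT's DIAGONAL WITH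
# `∃ (α₁, B, δ)` BEFORE THE HEIGHT — beta-an4's `hH0` slot (INTERFACE REQUEST D4, journal `HOME/CLAIMS.log` l.64394)** — the instantiation of this lineage's
# (K63) `B9Eq3126H1SupRowOfLetters.local_letter_H1_torus_const` with (L)(G₁,k) := (K64) `B9Eq326G1kSupRowClosed.exists_local_letter_G1k`, the `Q_k†` range∕size
# letter := ne9-leaf-03's (SBLT) `B9Eq315QkSingleBondLetter.norm_adjoint_QkW_apply_le_local_sharp`, the coarse point decay of `(Q_kG₁,kQ_k†)⁻¹` := ne9-leaf-03's
# (FCLK) `B9Eq3126QG1QInvPointDecayTowerDiagonalClosed.exists_bondPoint_decay_Kinv_diagonal_closed`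

statement-level skeleton of published theorems with citation tags; proofs where landed; nothing here is a claim about the Yang–Mills mass gap

CITATION HEADER (lean-in-tree rule).  Audit cell `pub-balaban`, sub-cell `t4`, BINDER row NE9; filed by NE9 crux-team LEAF PROVER 05
(`b2b-balaban-t4-ne9-formalise-leaf-05`, gen 87).  Composed BY NAME, nothing restated: (K63), (K64), (SBLT), (FCLK) as above; `B9Eq3126H1BlockDecayOfLettersTower.toCLM_H1k_eq`
(`H₁,k = G₁,k∘Q_k†∘K⁻¹`, `rfl`); `B9Eq326OperatorTower.QkW_surjective`; ne9-leaf-01's `B9Eq349BlockMultipliers.exists_block_clm_family`; `B9Eq349BlockDistanceWeight.tdist_shift_le_one`.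
Sources READ first-hand this generation (`paper:balaban1985-cmp99-background-propagators`, journal page = PDF page + 388): p. 397 (3.42), p. 399 Thm 3.3, p. 420 (3.126).
NOTHING of print's proof is reproduced; no constant of print is valued.

WHAT IS PROVED (sorry-free; proof lane — no `def`; [folklore] composition BY NAME).
* **`exists_local_letter_H1k`** — `∃ α₁ B δ > 0` BEFORE `∀ n η c₀ c₁ m U …` (the (K64) data block + (FCLK)'s `hαL : ∀ j, 50(d+1)αU j L^d ≤ 1∕2`, quantified over ALL
  depths as (FCLK) does — beta-an4's located caveat W-5 l.65113 (2)): for every coarse-bond field `z` supported over the bonds at base point `v` with `‖z(b′)‖ ≤ F`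
  and every fine bond `b`: `‖(H1k L m n φ η U hL αU hα1 hU1 hreg τ hαL hpos z)(b)‖ ≤ B·e^{−δ·d_m(Π(b₋), v)}·F`.  The `Q_k†` letter: size `M_Q = M_φ′M_φ·e^{100d(d+1)L^dA_Q}·2d`
  on the diagonal (`c₁∕(c₀L^{(n+1)d}) = 1`), range `1` (the «near» coarse bonds `Π(b₋) ∈ {c₋, c₋ + e_{c.2}}`, `tdist_shift_le_one`); the `K⁻¹` letter at price `√d`.
HONEST SCOPE.  OPTIONAL for the (D4) socket (beta-an4 composes `H₀ = G0∘Qs∘Inv0` itself); typed so that NE9 has `H₁,k`'s row BY NAME.  A theorem about the cell's MODEL;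
constants crude; nothing of [B9] Thm 3.1 ∕ 3.3 ∕ 3.11 or [B11] (45) asserted, valued or discharged; «NE9 ⇐ the named binders»; NE9 NOT PRINTED ∕ NOT PROVED; row WALLED
ON A MODEL (O-NE9-1; #5 UNRULED); spine PROVED 0∕9; rung (B)+1 on a finite T⁴ — NOT infinite volume, NOT mass gap, NOT BetaPertH, NOT Clay.  HONEST DEPENDENCY:
continuum YM on T⁴ ⇐ BetaPertH ∧ nine spine estimates (0/9 proved); BetaPertH ⇐ (D1) ∧ (D4) ∧ CAP+tail; G-an2-4 gates asym, D1 and NE2/3/4.  NEW file behind (K64) and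
(K63) (oleans); nothing modified.  Net new unproved facts: 0.
-/

noncomputable section

set_option autoImplicit false

open scoped InnerProductSpace ComplexConjugate BigOperators

namespace Literature.MathematicalPhysics.QuantumFieldTheory.Balaban1983to89.B9Eq3126H1kSupRowClosed

open B4Sect5Torus (TSite tdist tdist_nonneg tdist_symm tdist_self)
open B4Sect5Proof (latticeConst latticeConst_nonneg)
open B9SectCLatticeCarrier (Bond DirPair bpos btgt shift unshift)
open B9Eq311L2Pairing (WL2)
open B9Eq319QprimeTorus (fineP blockCoord)
open B7Prop1Explicit (U1 Wcx boxVec)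
open B11Eq103H1Complex (SiteL2K BondL2K KinvLatticeK)
open B9Eq310DeltaPrime (plaqHolU)
open B9Eq310HessianOperator (adTransportW)
open B9Eq315QTorus (perCfg cornerSite)
open B9Eq315QTower (towerP UlevOf)
open B9Eq316TowerFlatIsOneStep (towerP_eq_fineP_pow siteCast)
open B9Eq326OperatorTower (QkW laplaceAk G1k H1k QkW_surjective)
open B9Eq324DeltaPrimeATower (laplacePrimeAk)
open B9Eq349BlockMultipliers (exists_block_clm_family)
open B9Eq349BlockDistanceWeight (tdist_shift_le_one)
open B9Eq326G1kSupRowClosed (exists_local_letter_G1k)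
open B9Eq3126H1SupRowOfLetters (local_letter_H1_torus_const)
open B9Eq3126QG1QInvPointDecayTowerDiagonalClosed (exists_bondPoint_decay_Kinv_diagonal_closed)
open B9Eq3126H1BlockDecayOfLettersTower (toCLM_H1k_eq)
open B9Eq315QkSingleBondLetter (norm_adjoint_QkW_apply_le_local_sharp)

variable {d : ℕ} (hd : 1 ≤ d) (L : ℕ) [NeZero L] (hL : 1 ≤ L) (hL3 : 3 ≤ L)
  {𝔸 : Type*} [NormedRing 𝔸] [NormedAlgebra ℂ 𝔸] [CompleteSpace 𝔸] [NormOneClass 𝔸] [StarRing 𝔸] [NormedStarGroup 𝔸] [StarModule ℂ 𝔸]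
  {W : Type*} [NormedAddCommGroup W] [InnerProductSpace ℂ W] [FiniteDimensional ℂ W] (φ : W ≃ₗ[ℂ] 𝔸)
  {Mφ Mφ' : ℝ} (hMφ : 0 ≤ Mφ) (hMφ' : 0 ≤ Mφ') (hφ : ∀ w, ‖φ w‖ ≤ Mφ * ‖w‖) (hφ' : ∀ X, ‖φ.symm X‖ ≤ Mφ' * ‖X‖) (hstar : ∀ X : 𝔸, ‖star X‖ ≤ ‖X‖)
  {a : ℝ} (ha : 0 < a) {a' : ℝ} (ha' : 0 < a') {ϱ : ℝ} (hϱ0 : 0 ≤ ϱ) (hϱ1 : ϱ < 1)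
  (τ : 𝔸 →ₗ[ℂ] ℂ) {Cτ : ℝ} (hτ : ∀ X, ‖τ X‖ ≤ Cτ * ‖X‖) (hCτ : 0 ≤ Cτ) {Mτ : ℝ} (hτm : ∀ X Y : 𝔸, ‖τ (X * Y)‖ ≤ Mτ * ‖X‖ * ‖Y‖) (hMτ : 0 ≤ Mτ)
  {ρw : ℝ} (hρw : 0 ≤ ρw)
  (hτ₁ : ∀ X : 𝔸, τ (star X) = conj (τ X)) (hτ₂ : ∀ X Y : 𝔸, τ (X * Y) = τ (Y * X)) (hφτ : ∀ X Y : 𝔸, ⟪φ.symm X, φ.symm Y⟫_ℂ = τ (star X * Y))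
  (AQ : ℝ)

omit [NeZero L] in
/-- `e^{−r t} ≤ e^{−κ t}` for `κ ≤ r`, `0 ≤ t`. [folklore] -/
private theorem exp_weaken' {r κ t : ℝ} (hκ : κ ≤ r) (ht : 0 ≤ t) : Real.exp (-(r * t)) ≤ Real.exp (-(κ * t)) :=
  Real.exp_le_exp.2 (by nlinarith)

include hd hL hL3 hMφ hMφ' hφ hφ' hstar ha ha' hϱ0 hϱ1 hτ hCτ hτm hMτ hρw hτ₁ hτ₂ hφτ in
/-- **THE SUP ROW OF `H₁,k(U)` ON PRINT's DIAGONAL — beta-an4's `hH0` shape, UNCONDITIONAL on the cell's MODEL letters.**  (K63) `local_letter_H1_torus_const` at the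
tower: `G := G₁,k` with (K64)'s END letter, `Qa := Q_k†` with (SBLT)'s single-bond letter (size AND range from the one «near» inequality), `Kinv := (Q_kG₁,kQ_k†)⁻¹` with
(FCLK)'s point decay, `hQ := QkW_surjective … hαL`, `H₁,k = G₁,k∘Q_k†∘K⁻¹` by `toCLM_H1k_eq`; common rate `κ := min(δ_G, r₁)`, `δ := κ∕2`, `α₁ := min` of the
thresholds. [cite: Balaban1985BackgroundPropagators, (3.126) p.420, (3.133) p.422, Thm 3.3 p.399, Thm 3.11 p.416; Balaban1985Variational, (45) p.285] -/
theorem exists_local_letter_H1k :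
    ∃ α₁ B δ : ℝ, 0 < α₁ ∧ 0 ≤ B ∧ 0 < δ ∧
      ∀ (n : ℕ) (η : ℝ) (_hηL : η * (L : ℝ) ^ (n + 1) = 1) (c₀ c₁ : ℝ) [Fact (0 < c₀)] [Fact (0 < c₁)]
        (_hw : c₀ * ((L : ℝ) ^ (n + 1)) ^ d = c₁) (_hρ : |η| ^ d / c₀ ≤ ρw) (m : Fin d → ℕ) [∀ i, NeZero (m i)] (_hm : ∀ i, 1 ≤ m i)
        (U : Bond d (towerP L m (n + 1)) → 𝔸ˣ) (αU : ℕ → ℝ) (_hα0 : ∀ j, 0 ≤ αU j) (hα1 : ∀ j, αU j ≤ 1 / 64)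
        (hαL : ∀ j, 50 * (d + 1) * αU j * (L : ℝ) ^ d ≤ 1 / 2)
        (hU1 : ∀ (j : ℕ) (x : B7Prop1Explicit.Site d) (k : Fin d), perCfg (towerP L m (j + 1)) (UlevOf L m (n + 1) U j) x k ∈ U1 𝔸)
        (hreg : ∀ (j : ℕ) (y : TSite d (towerP L m j)) (k : Fin d) (ρ' : Fin d → Fin L),
          ‖((Wcx L (perCfg (towerP L m (j + 1)) (UlevOf L m (n + 1) U j)) (cornerSite L y) k (boxVec L ρ') : 𝔸ˣ) : 𝔸) - 1‖ ≤ αU j)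
        (εU : ℕ → ℝ) (_hεU : ∀ j, 0 ≤ εU j) (_hUε : ∀ (j : ℕ) (b : Bond d (towerP L m (j + 1))), ‖(UlevOf L m (n + 1) U j b : 𝔸) - 1‖ ≤ εU j)
        (_hLb : ∀ (j : ℕ) (b : Bond d (towerP L m (j + 1))), UlevOf L m (n + 1) U j b ∈ U1 𝔸)
        (α : ℝ) (_hα : 0 ≤ α) (_hαle : α ≤ α₁)
        (hUst : ∀ b, star (U b : 𝔸) = (((U b)⁻¹ : 𝔸ˣ) : 𝔸)) (_hUb : ∀ b, U b ∈ U1 𝔸) (_hUη : ∀ b, ‖(U b : 𝔸) - 1‖ ≤ α * η)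
        (_hpl : ∀ p : B9SectCLatticeCarrier.Plaq d (towerP L m (n + 1)), ‖(plaqHolU U p : 𝔸) - 1‖ ≤ α * η ^ 2)
        (_hUgrad : ∀ (x : TSite d (towerP L m (n + 1))) (μ : Fin d), ‖(U (x, μ) : 𝔸) - U (unshift μ x, μ)‖ ≤ α * η ^ 2)
        (_hRlev : ∀ (j : ℕ) (b : Bond d (towerP L m (j + 1))) (w : W), ‖adTransportW φ (UlevOf L m (n + 1) U j) b w‖ ≤ ‖w‖)
        (_hεg : ∀ j < n + 1, εU j ≤ α * ϱ ^ j) (_hAQ : ∑ j ∈ Finset.range (n + 1), αU j ≤ AQ)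
        (hpos' : ∀ x : SiteL2K ℂ d (towerP L m (n + 1)) c₀ W, x ≠ 0 → 0 < RCLike.re ⟪x, laplacePrimeAk L m n φ η U a' (c₁ := c₁) x⟫_ℂ)
        (hpos : ∀ x : BondL2K ℂ d (towerP L m (n + 1)) c₀ W, x ≠ 0 →
          0 < RCLike.re ⟪x, laplaceAk L m n φ η U hL αU hα1 hU1 hreg τ (c₀ := c₀) (c₁ := c₁) a x⟫_ℂ)
        (v : TSite d m) (z : BondL2K ℂ d m c₁ W) (F : ℝ)
        (_hzv : ∀ b', bpos b' ≠ v → WL2.equiv ℂ (fun _ : Bond d m => c₁) W z b' = 0)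
        (_hzF : ∀ b', ‖WL2.equiv ℂ (fun _ : Bond d m => c₁) W z b'‖ ≤ F) (b : Bond d (towerP L m (n + 1))),
        ‖WL2.equiv ℂ (fun _ : Bond d (towerP L m (n + 1)) => c₀) W (H1k L m n φ η U hL αU hα1 hU1 hreg τ (c₀ := c₀) (c₁ := c₁) hαL hpos z) b‖ ≤
          B * Real.exp (-(δ * tdist m (blockCoord (L ^ (n + 1)) m (siteCast (towerP_eq_fineP_pow L m (n + 1)) (bpos b))) v)) * F := by
  classical
  obtain ⟨αG, BG, δG, hαG, hBG, hδG, HG⟩ := exists_local_letter_G1k hd L hL hL3 φ hMφ hMφ' hφ hφ' hstar ha ha' hϱ0 hϱ1 τ hτ hCτ hτm hMτ hρw hτ₁ hτ₂ hφτ AQ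
  obtain ⟨αK, r₁, AK, hαK, hr₁, hAK, HK⟩ := exists_bondPoint_decay_Kinv_diagonal_closed hd L hL hL3 φ hMφ hMφ' hφ hφ' hstar ha ha' hϱ0 hϱ1 τ hτ hCτ hτm
    hMτ hρw hτ₁ hτ₂ hφτ
  set κ : ℝ := min δG r₁ with hκdef
  have hκ0 : 0 < κ := lt_min hδG hr₁
  have hκG : κ ≤ δG := min_le_left _ _
  have hκK : κ ≤ r₁ := min_le_right _ _
  set MQ : ℝ := Mφ' * Real.exp (100 * d * (d + 1) * (L : ℝ) ^ d * AQ) * Mφ * ((2 * d : ℕ) : ℝ) with hMQ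
  have hMQ0 : 0 ≤ MQ := by positivity
  set K : ℝ := latticeConst d (κ - κ / 2) with hKdef
  have hK0 : 0 ≤ K := latticeConst_nonneg d (by linarith)
  set Bs : ℝ := (AK * Real.sqrt d) * (MQ * Real.exp (κ * 1)) * K * BG * K with hBs
  have hBs0 : 0 ≤ Bs := by positivity
  refine ⟨min αG αK, Bs, κ / 2, lt_min hαG hαK, hBs0, by positivity, ?_⟩
  intro n η hηL c₀ c₁ _ _ hw hρ m _ hm U αU hα0 hα1 hαL hU1 hreg εU hεU hUε hLb α hα hαle hUst hUb hUη hpl hUgrad hRlev hεg hAQ hpos' hpos v z F hzv hzF b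
  have hc₀ : (0 : ℝ) < c₀ := Fact.out
  have hc₁ : (0 : ℝ) < c₁ := Fact.out
  haveI : Nonempty (Bond d m) := ⟨(v, ⟨0, hd⟩)⟩
  have hF0 : 0 ≤ F := (norm_nonneg _).trans (hzF (v, ⟨0, hd⟩))
  have hQ : Function.Surjective (QkW L m n φ U hL αU hα1 hU1 hreg (c₀ := c₀) (c₁ := c₁)) := QkW_surjective L m n φ U hL αU hα1 hU1 hreg hαL
  -- the families
  obtain ⟨rF, hrF⟩ := exists_block_clm_family (𝕜 := ℂ) (w := fun _ : Bond d m => c₁) (V := W) (fun b' : Bond d m => bpos b')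
  -- the three CLMs
  obtain ⟨Gcl, hGcl⟩ : ∃ T : BondL2K ℂ d (towerP L m (n + 1)) c₀ W →L[ℂ] BondL2K ℂ d (towerP L m (n + 1)) c₀ W,
      T = LinearMap.toContinuousLinearMap (G1k L m n φ η U hL αU hα1 hU1 hreg τ (c₀ := c₀) (c₁ := c₁) hpos) := ⟨_, rfl⟩
  obtain ⟨Qcl, hQcl⟩ : ∃ T : BondL2K ℂ d m c₁ W →L[ℂ] BondL2K ℂ d (towerP L m (n + 1)) c₀ W,
      T = LinearMap.toContinuousLinearMap (LinearMap.adjoint (QkW L m n φ U hL αU hα1 hU1 hreg (c₀ := c₀) (c₁ := c₁))) := ⟨_, rfl⟩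
  obtain ⟨Kcl, hKcl⟩ : ∃ T : BondL2K ℂ d m c₁ W →L[ℂ] BondL2K ℂ d m c₁ W, T = LinearMap.toContinuousLinearMap (KinvLatticeK hpos hQ) := ⟨_, rfl⟩
  -- (L)(G₁,k) at rate κ
  have hG : ∀ (v : TSite d m) (f : BondL2K ℂ d (towerP L m (n + 1)) c₀ W) (F : ℝ),
      (∀ x, blockCoord (L ^ (n + 1)) m (siteCast (towerP_eq_fineP_pow L m (n + 1)) (bpos x)) ≠ v →
        WL2.equiv ℂ (fun _ : Bond d (towerP L m (n + 1)) => c₀) W f x = 0) →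
      (∀ x, ‖WL2.equiv ℂ (fun _ : Bond d (towerP L m (n + 1)) => c₀) W f x‖ ≤ F) →
      ∀ x, ‖WL2.equiv ℂ (fun _ : Bond d (towerP L m (n + 1)) => c₀) W (Gcl f) x‖ ≤
        BG * Real.exp (-(κ * tdist m (blockCoord (L ^ (n + 1)) m (siteCast (towerP_eq_fineP_pow L m (n + 1)) (bpos x))) v)) * F := by
    intro v f F hfv hfF x
    have hF : 0 ≤ F := (norm_nonneg _).trans (hfF x)
    have h := HG n η hηL c₀ c₁ hw hρ m hm U αU hα0 hα1 hU1 hreg εU hεU hUε hLb α hα (hαle.trans (min_le_left _ _)) hUst hUb hUη hpl hUgrad hRlev hεg hAQ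
      hpos' hpos v f F hfv hfF x
    rw [hGcl, LinearMap.coe_toContinuousLinearMap']
    exact h.trans (mul_le_mul_of_nonneg_right (mul_le_mul_of_nonneg_left (exp_weaken' hκG (tdist_nonneg m _ _)) hBG) hF)
  -- `Q_k†`: size and range from the single-bond letter
  have hdiag : c₁ / c₀ * (Mφ' * ((((L : ℝ) ^ (n + 1)) ^ d)⁻¹ * Real.exp (100 * d * (d + 1) * (L : ℝ) ^ d * AQ)) * Mφ) * ((2 * d : ℕ) : ℝ) = MQ := by
    have hLp : (0 : ℝ) < ((L : ℝ) ^ (n + 1)) ^ d := by positivity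
    rw [hMQ, ← hw]
    field_simp
  have hQM : ∀ (z : BondL2K ℂ d m c₁ W) (F : ℝ), (∀ x, ‖WL2.equiv ℂ (fun _ : Bond d m => c₁) W z x‖ ≤ F) →
      ∀ x, ‖WL2.equiv ℂ (fun _ : Bond d (towerP L m (n + 1)) => c₀) W (Qcl z) x‖ ≤ MQ * F := by
    intro z F hzF x
    have hF : 0 ≤ F := (norm_nonneg _).trans (hzF (v, ⟨0, hd⟩))
    have h := norm_adjoint_QkW_apply_le_local_sharp L m n φ (c₀ := c₀) U hL αU hα0 hα1 hU1 hreg hMφ hφ hMφ' hφ' hAQ z x hF (fun c _ => hzF c)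
    rw [hQcl, LinearMap.coe_toContinuousLinearMap', ← hdiag]
    exact h
  have hQρ : ∀ (v : TSite d m) (z : BondL2K ℂ d m c₁ W), (∀ x, bpos x ≠ v → WL2.equiv ℂ (fun _ : Bond d m => c₁) W z x = 0) →
      ∀ x, (1 : ℝ) < tdist m (blockCoord (L ^ (n + 1)) m (siteCast (towerP_eq_fineP_pow L m (n + 1)) (bpos x))) v →
        WL2.equiv ℂ (fun _ : Bond d (towerP L m (n + 1)) => c₀) W (Qcl z) x = 0 := by
    intro v z hzv x hx
    have hnear : ∀ c : Bond d m, (blockCoord (L ^ (n + 1)) m (siteCast (towerP_eq_fineP_pow L m (n + 1)) x.1) = c.1 ∨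
        blockCoord (L ^ (n + 1)) m (siteCast (towerP_eq_fineP_pow L m (n + 1)) x.1) = shift c.2 c.1) →
        ‖WL2.equiv ℂ (fun _ : Bond d m => c₁) W z c‖ ≤ 0 := by
      intro c hc
      have hcv : bpos c ≠ v := by
        intro hcv
        rcases hc with h1 | h2
        · have : tdist m (blockCoord (L ^ (n + 1)) m (siteCast (towerP_eq_fineP_pow L m (n + 1)) (bpos x))) v = 0 := by
            rw [show bpos x = x.1 from rfl, h1, show c.1 = bpos c from rfl, hcv, tdist_self]
          linarith
        · have : tdist m (blockCoord (L ^ (n + 1)) m (siteCast (towerP_eq_fineP_pow L m (n + 1)) (bpos x))) v ≤ 1 := by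
            rw [show bpos x = x.1 from rfl, h2, show c.1 = bpos c from rfl, hcv, tdist_symm hm]
            exact tdist_shift_le_one hm v c.2
          linarith
      rw [hzv c hcv, norm_zero]
    have h := norm_adjoint_QkW_apply_le_local_sharp L m n φ (c₀ := c₀) U hL αU hα0 hα1 hU1 hreg hMφ hφ hMφ' hφ' hAQ z x le_rfl hnear
    rw [mul_zero] at h
    rw [hQcl, LinearMap.coe_toContinuousLinearMap']
    exact norm_le_zero_iff.1 h
  -- `K⁻¹`'s coarse point decay at rate κ
  have hKblk : ∀ y₀ y₁, ‖rF y₁ ∘L Kcl ∘L rF y₀‖ ≤ AK * Real.exp (-(κ * tdist m y₀ y₁)) := by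
    intro y₀ y₁
    rw [hKcl]
    have h := HK n η hηL c₀ c₁ hw hρ m hm U αU hα0 hα1 hαL hU1 hreg εU hεU hUε hLb α hα (hαle.trans (min_le_right _ _)) hUst hUb hUη hpl hεg hpos hQ
      rF hrF y₀ y₁
    exact h.trans (mul_le_mul_of_nonneg_left (exp_weaken' hκK (tdist_nonneg m _ _)) hAK)
  -- the coarse-bond block mass `d·c₁`
  have hμF : ∀ u : TSite d m, ∑ x : Bond d m, (if bpos x = u then c₁ else 0) ≤ (d : ℝ) * c₁ := by
    intro u
    rw [Fintype.sum_prod_type, Finset.sum_comm]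
    have hin : ∀ μ : Fin d, ∑ y : TSite d m, (if bpos ((y, μ) : Bond d m) = u then c₁ else 0) = c₁ := fun μ => by
      simp only [show ∀ y : TSite d m, bpos ((y, μ) : Bond d m) = y from fun _ => rfl, Finset.sum_ite_eq', Finset.mem_univ, if_true]
    simp only [hin, Finset.sum_const, Finset.card_univ, Fintype.card_fin, nsmul_eq_mul, le_refl]
  -- the assembly
  haveI : Nonempty (Bond d m) := ⟨(v, ⟨0, hd⟩)⟩
  have hκ' : κ / 2 < κ := by linarith
  have h := local_letter_H1_torus_const (𝕜 := ℂ) (V := W)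
    (fun x : Bond d (towerP L m (n + 1)) => blockCoord (L ^ (n + 1)) m (siteCast (towerP_eq_fineP_pow L m (n + 1)) (bpos x)))
    (fun b' : Bond d m => bpos b') Gcl Qcl Kcl hrF hm (ρ := 1) hBG hMQ0 hAK (by positivity) hκ' hc₁ (fun _ => rfl) (Nat.cast_nonneg d) hμF
    hG hQM hQρ hKblk v z F hzv hzF b
  have e : (Gcl ∘L Qcl ∘L Kcl) z = H1k L m n φ η U hL αU hα1 hU1 hreg τ (c₀ := c₀) (c₁ := c₁) hαL hpos z := by
    rw [hGcl, hQcl, hKcl, ← toCLM_H1k_eq φ η U τ hL αU hα1 hU1 hreg hαL hpos hQ, LinearMap.coe_toContinuousLinearMap']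
  rw [e] at h
  rw [hBs, hKdef]
  exact h

end Literature.MathematicalPhysics.QuantumFieldTheory.Balaban1983to89.B9Eq3126H1kSupRowClosed

end
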